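import Summits.HodgeConjecture.HodgeCM.PerL34.LocalFactors.SchrodingerIrreducible_1

/-! PORT of `HodgeCM/PerL34/LocalFactors/SchrodingerIrreducible.lean` (HodgeCMPerL run 82) — part 2: continuation of `Summits.HodgeConjecture.HodgeCM.PerL34.LocalFactors.SchrodingerIrreducible_1` (split at a top-level declaration boundary by port_pkg.py; scope re-opened below; declarations unchanged). -/

-- port_pkg: scope re-opened for this part (file-level context, then the namespace/section stack open at the cut)
set_option autoImplicit false
noncomputable section
open MeasureTheory MeasureTheory.Measure Set Complex Filter Topology Function
open scoped ENNReal NNReal Pointwise InnerProductSpace symmDiff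
namespace HodgeCM
namespace PerL34
namespace LocalFactors
namespace SchrodingerIrreducible
open SchrodingerLevi DilationModel
section Density
variable {X : Type*} [AddCommGroup X] [TopologicalSpace X] [IsTopologicalAddGroup X]
  [MeasurableSpace X] [BorelSpace X] (μ : Measure X) [μ.IsAddHaarMeasure]
omit [TopologicalSpace X] [IsTopologicalAddGroup X] [MeasurableSpace X] [BorelSpace X] in
/-- (Ported verbatim from the HodgeCMPerL package; no docstring in the source.) -/
theorem self_mem_coset (B : AddSubgroup X) (a : X) : a ∈ coset B a := by
  rw [mem_coset, sub_self]; exact B.zero_mem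

/-- (Ported verbatim from the HodgeCMPerL package; no docstring in the source.) -/
theorem measurableSet_coset {B : AddSubgroup X} (hB : MeasurableSet (B : Set X)) (a : X) :
    MeasurableSet (coset B a) :=
  hB.preimage (measurable_add_const (-a))

/-- (Ported verbatim from the HodgeCMPerL package; no docstring in the source.) -/
theorem measure_coset {B : AddSubgroup X} (hB : MeasurableSet (B : Set X)) (a : X) : μ (coset B a) = μ B :=
  (measurePreserving_add_right μ (-a)).measure_preimage hB.nullMeasurableSet

omit [MeasurableSpace X] [BorelSpace X] in
/-- (Ported verbatim from the HodgeCMPerL package; no docstring in the source.) -/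
theorem isOpen_coset {B : AddSubgroup X} (hB : IsOpen (B : Set X)) (a : X) : IsOpen (coset B a) :=
  hB.preimage (continuous_id.add continuous_const)

omit [TopologicalSpace X] [IsTopologicalAddGroup X] [MeasurableSpace X] [BorelSpace X] in
/-- nested cosets are disjoint or comparable -/
theorem coset_subset_of_le {B B' : AddSubgroup X} (h : B' ≤ B) {a a' x : X} (hx : x ∈ coset B a)
    (hx' : x ∈ coset B' a') : coset B' a' ⊆ coset B a := by
  intro u hu
  rw [mem_coset] at *
  have : u - a = (u - a') - (x - a') + (x - a) := by abel
  rw [this]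
  exact B.add_mem (B.sub_mem (h hu) (h hx')) hx

/-- partial unions of a sequence of sets -/
def punion (f : ℕ → Set X) : ℕ → Set X
  | 0 => f 0
  | n + 1 => punion f n ∪ f (n + 1)

omit [AddCommGroup X] [TopologicalSpace X] [IsTopologicalAddGroup X] [MeasurableSpace X] [BorelSpace X] in
/-- (Ported verbatim from the HodgeCMPerL package; no docstring in the source.) -/
theorem punion_subset (f : ℕ → Set X) (n : ℕ) : punion f n ⊆ ⋃ i, f i := by
  induction n with
  | zero => exact subset_iUnion f 0
  | succ n ih => exact union_subset ih (subset_iUnion f (n + 1))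

omit [AddCommGroup X] [TopologicalSpace X] [IsTopologicalAddGroup X] [MeasurableSpace X] [BorelSpace X] in
/-- (Ported verbatim from the HodgeCMPerL package; no docstring in the source.) -/
theorem subset_punion (f : ℕ → Set X) : ∀ {i n : ℕ}, i ≤ n → f i ⊆ punion f n
  | i, 0, h => by rw [Nat.le_zero.1 h]; exact subset_rfl
  | i, n + 1, h => by
      rcases Nat.of_le_succ h with h' | h'
      · exact (subset_punion f h').trans subset_union_left
      · rw [h']; exact subset_union_right

omit [AddCommGroup X] [TopologicalSpace X] [IsTopologicalAddGroup X] [MeasurableSpace X] [BorelSpace X] in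
/-- (Ported verbatim from the HodgeCMPerL package; no docstring in the source.) -/
theorem iUnion_punion (f : ℕ → Set X) : ⋃ n, punion f n = ⋃ n, f n :=
  subset_antisymm (iUnion_subset fun n => punion_subset f n)
    (iUnion_subset fun n => (subset_punion f le_rfl).trans (subset_iUnion _ n))

omit [AddCommGroup X] [TopologicalSpace X] [IsTopologicalAddGroup X] [MeasurableSpace X] [BorelSpace X] in
/-- (Ported verbatim from the HodgeCMPerL package; no docstring in the source.) -/
theorem monotone_punion (f : ℕ → Set X) : Monotone (punion f) :=
  monotone_nat_of_le_succ fun _ => subset_union_left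

omit [AddCommGroup X] [TopologicalSpace X] [IsTopologicalAddGroup X] [BorelSpace X] in
/-- (Ported verbatim from the HodgeCMPerL package; no docstring in the source.) -/
theorem measurableSet_punion {f : ℕ → Set X} (hf : ∀ i, MeasurableSet (f i)) :
    ∀ n, MeasurableSet (punion f n)
  | 0 => hf 0
  | n + 1 => (measurableSet_punion hf n).union (hf _)

omit [AddCommGroup X] [TopologicalSpace X] [IsTopologicalAddGroup X] [MeasurableSpace X] [BorelSpace X] in
/-- (Ported verbatim from the HodgeCMPerL package; no docstring in the source.) -/
theorem disjoint_punion {f : ℕ → Set X} (hd : Pairwise (Disjoint on f)) :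
    ∀ n m : ℕ, n < m → Disjoint (punion f n) (f m)
  | 0, _, h => hd (Nat.ne_of_lt h)
  | n + 1, m, h => disjoint_union_left.2 ⟨disjoint_punion hd n m (Nat.lt_of_succ_lt h), hd (Nat.ne_of_lt h)⟩

omit [AddCommGroup X] [TopologicalSpace X] [IsTopologicalAddGroup X] [BorelSpace X] [μ.IsAddHaarMeasure] in
/-- (L) a bounded operator killing the indicators of the members of a disjoint sequence of sets with union
of finite measure kills the indicator of the union (`L²`-continuity) -/
theorem map_indicatorConstLp_iUnion_eq_zero (T : Lp ℂ 2 μ →L[ℂ] Lp ℂ 2 μ) (f : ℕ → Set X)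
    (hfm : ∀ i, MeasurableSet (f i)) (hdisj : Pairwise (Disjoint on f)) (hfin : μ (⋃ i, f i) ≠ ∞)
    (h0 : ∀ i (hi : μ (f i) ≠ ∞), T (indicatorConstLp 2 (hfm i) hi (1 : ℂ)) = 0) :
    T (indicatorConstLp 2 (MeasurableSet.iUnion hfm) hfin (1 : ℂ)) = 0 := by
  have hpm := measurableSet_punion hfm
  have hpf : ∀ n, μ (punion f n) ≠ ∞ := fun n =>
    ((measure_mono (punion_subset f n)).trans_lt hfin.lt_top).ne
  have hff : ∀ i, μ (f i) ≠ ∞ := fun i => ((measure_mono (subset_iUnion f i)).trans_lt hfin.lt_top).ne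
  have hstep : ∀ n, T (indicatorConstLp 2 (hpm n) (hpf n) (1 : ℂ)) = 0 := by
    intro n
    induction n with
    | zero => exact h0 0 (hff 0)
    | succ n ih =>
      have h' : indicatorConstLp 2 (hpm (n + 1)) (hpf (n + 1)) (1 : ℂ) =
          indicatorConstLp 2 (hpm n) (hpf n) 1 + indicatorConstLp 2 (hfm (n + 1)) (hff (n + 1)) 1 :=
        indicatorConstLp_disjoint_union (hpm n) (hfm (n + 1)) (hpf n) (hff (n + 1))
          (disjoint_punion hdisj n (n + 1) (Nat.lt_succ_self n)) (1 : ℂ)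
      rw [h', map_add, ih, h0 (n + 1) (hff (n + 1)), add_zero]
  have htend : Tendsto (fun n => indicatorConstLp 2 (hpm n) (hpf n) (1 : ℂ)) atTop
      (𝓝 (indicatorConstLp 2 (MeasurableSet.iUnion hfm) hfin (1 : ℂ))) := by
    refine tendsto_indicatorConstLp_set (by norm_num) ?_
    have hanti : Antitone fun n => (⋃ i, f i) \ punion f n :=
      fun n m hnm => Set.sdiff_subset_sdiff_right (monotone_punion f hnm)
    have hlim := tendsto_measure_iInter_atTop (μ := μ)
      (fun n => ((MeasurableSet.iUnion hfm).diff (hpm n)).nullMeasurableSet) hanti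
      ⟨0, ((measure_mono Set.sdiff_subset).trans_lt hfin.lt_top).ne⟩
    have hempty : ⋂ n, (⋃ i, f i) \ punion f n = ∅ := by
      rw [← Set.sdiff_iUnion, iUnion_punion, Set.sdiff_self]
    rw [hempty, measure_empty] at hlim
    refine hlim.congr fun n => ?_
    simp only [Function.comp_apply]
    rw [symmDiff_of_le (punion_subset f n)]
  have hT : Tendsto (fun _ : ℕ => (0 : Lp ℂ 2 μ)) atTop
      (𝓝 (T (indicatorConstLp 2 (MeasurableSet.iUnion hfm) hfin (1 : ℂ)))) :=
    ((T.continuous.tendsto _).comp htend).congr fun n => by simp only [Function.comp_apply, hstep]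
  exact tendsto_nhds_unique hT tendsto_const_nhds

/-- **(D) density.**  A bounded operator on `L²(X)` killing the indicator of every coset of every member
of a decreasing neighbourhood basis `B` of compact open subgroups is zero. -/
theorem eq_zero_of_vanish_on_cosets [SecondCountableTopology X] (B : ℕ → AddSubgroup X)
    (hBo : ∀ k, IsOpen (B k : Set X)) (hBc : ∀ k, IsCompact (B k : Set X)) (hBanti : Antitone B)
    (hBnhds : ∀ U ∈ 𝓝 (0 : X), ∃ k, (B k : Set X) ⊆ U)
    (T : Lp ℂ 2 μ →L[ℂ] Lp ℂ 2 μ)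
    (hT : ∀ k a (h : μ (coset (B k) a) ≠ ∞),
      T (indicatorConstLp 2 (measurableSet_coset (hBo k).measurableSet a) h (1 : ℂ)) = 0) :
    T = 0 := by
  classical
  have hSm : ∀ k a, MeasurableSet (coset (B k) a) := fun k a => measurableSet_coset (hBo k).measurableSet a
  have hSf : ∀ k a, μ (coset (B k) a) ≠ ∞ := fun k a => by
    rw [measure_coset μ (hBo k).measurableSet a]; exact (hBc k).measure_lt_top.ne
  -- the family of all cosets is a basis of the topology and a π-system
  set 𝒮 : Set (Set X) := {S | ∃ k a, S = coset (B k) a} with h𝒮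
  have hbasis : TopologicalSpace.IsTopologicalBasis 𝒮 := by
    apply TopologicalSpace.isTopologicalBasis_of_isOpen_of_nhds
    · rintro _ ⟨k, a, rfl⟩
      exact isOpen_coset (hBo k) a
    · intro a U haU hU
      have hmem : (fun t : X => a + t) ⁻¹' U ∈ 𝓝 (0 : X) :=
        (hU.preimage (continuous_const.add continuous_id)).mem_nhds (by simpa using haU)
      obtain ⟨k, hk⟩ := hBnhds _ hmem
      refine ⟨coset (B k) a, ⟨k, a, rfl⟩, self_mem_coset _ _, fun u hu => ?_⟩
      rw [mem_coset] at hu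
      simpa using hk hu
  have hgen : ‹MeasurableSpace X› = MeasurableSpace.generateFrom 𝒮 := by
    rw [‹BorelSpace X›.measurable_eq]; exact hbasis.borel_eq_generateFrom
  have hpi : IsPiSystem 𝒮 := by
    rintro _ ⟨k, a, rfl⟩ _ ⟨j, a', rfl⟩ ⟨x, hx, hx'⟩
    rcases le_total k j with hkj | hjk
    · exact ⟨j, a', Set.inter_eq_right.2 (coset_subset_of_le (hBanti hkj) hx hx')⟩
    · exact ⟨k, a, Set.inter_eq_left.2 (coset_subset_of_le (hBanti hjk) hx' hx)⟩
  -- Dynkin: `T 1_{t ∩ S₀} = 0` for every measurable `t` and every coset `S₀` of `B 0`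
  have hD : ∀ t (ht : MeasurableSet t), ∀ a₀ : X,
      T (indicatorConstLp 2 (ht.inter (hSm 0 a₀))
        (((measure_mono Set.inter_subset_right).trans_lt (hSf 0 a₀).lt_top).ne) (1 : ℂ)) = 0 := by
    intro t ht
    induction t, ht using MeasurableSpace.induction_on_inter hgen hpi with
    | empty =>
      intro a₀
      rw [indicatorConstLp_set_congr μ _ _ MeasurableSet.empty (by simp) (Set.empty_inter _) 1,
        indicatorConstLp_empty, map_zero]
    | basic t ht' =>
      obtain ⟨k, a, rfl⟩ := ht'
      intro a₀
      by_cases hne : (coset (B k) a ∩ coset (B 0) a₀).Nonempty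
      · obtain ⟨x, hx, hx₀⟩ := hne
        have hsub : coset (B k) a ⊆ coset (B 0) a₀ := coset_subset_of_le (hBanti (Nat.zero_le k)) hx₀ hx
        rw [indicatorConstLp_set_congr μ _ _ (hSm k a) (hSf k a) (Set.inter_eq_left.2 hsub) 1]
        exact hT k a (hSf k a)
      · rw [indicatorConstLp_set_congr μ _ _ MeasurableSet.empty (by simp) (Set.not_nonempty_iff_eq_empty.1 hne) 1,
          indicatorConstLp_empty, map_zero]
    | compl t ht iht =>
      intro a₀
      have hdisj : Disjoint (t ∩ coset (B 0) a₀) (tᶜ ∩ coset (B 0) a₀) :=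
        disjoint_compl_right.mono inter_subset_left inter_subset_left
      have hunion : t ∩ coset (B 0) a₀ ∪ tᶜ ∩ coset (B 0) a₀ = coset (B 0) a₀ := by
        rw [← Set.union_inter_distrib_right, Set.union_compl_self, Set.univ_inter]
      have hf1 : μ (t ∩ coset (B 0) a₀) ≠ ∞ :=
        ((measure_mono Set.inter_subset_right).trans_lt (hSf 0 a₀).lt_top).ne
      have hf2 : μ (tᶜ ∩ coset (B 0) a₀) ≠ ∞ :=
        ((measure_mono Set.inter_subset_right).trans_lt (hSf 0 a₀).lt_top).ne
      have hsum := indicatorConstLp_disjoint_union (p := 2) (μ := μ) (ht.inter (hSm 0 a₀))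
        (ht.compl.inter (hSm 0 a₀)) hf1 hf2 hdisj (1 : ℂ)
      have hS : T (indicatorConstLp 2 ((ht.inter (hSm 0 a₀)).union (ht.compl.inter (hSm 0 a₀)))
          (((measure_mono (hunion.le)).trans_lt (hSf 0 a₀).lt_top).ne) (1 : ℂ)) = 0 := by
        rw [indicatorConstLp_set_congr μ _ _ (hSm 0 a₀) (hSf 0 a₀) hunion 1]
        exact hT 0 a₀ (hSf 0 a₀)
      rw [hsum, map_add, iht a₀, zero_add] at hS
      exact hS
    | iUnion f hdisj hfm ihf =>
      intro a₀
      have hfin' : μ (⋃ i, f i ∩ coset (B 0) a₀) ≠ ∞ :=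
        ((measure_mono (iUnion_subset fun i => inter_subset_right)).trans_lt (hSf 0 a₀).lt_top).ne
      have key := map_indicatorConstLp_iUnion_eq_zero μ T (fun i => f i ∩ coset (B 0) a₀)
        (fun i => (hfm i).inter (hSm 0 a₀))
        (fun i j hij => (hdisj hij).mono inter_subset_left inter_subset_left) hfin'
        (fun i _ => ihf i a₀)
      rw [indicatorConstLp_set_congr μ _ _ (MeasurableSet.iUnion fun i => (hfm i).inter (hSm 0 a₀)) hfin'
        (Set.iUnion_inter _ f) 1]
      exact key
  -- all measurable sets of finite measure, via a countable cover by cosets of `B 0`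
  have hfinite : ∀ t (ht : MeasurableSet t) (hμt : μ t ≠ ∞), T (indicatorConstLp 2 ht hμt (1 : ℂ)) = 0 := by
    intro t ht hμt
    obtain ⟨d, hd⟩ := TopologicalSpace.exists_dense_seq X
    set C : ℕ → Set X := fun m => coset (B 0) (d m) with hCdef
    have hCm : ∀ m, MeasurableSet (C m) := fun m => hSm 0 (d m)
    have hcover : ∀ x : X, ∃ m, x ∈ C m := by
      intro x
      have hopen : IsOpen {y : X | x - y ∈ B 0} := (hBo 0).preimage (continuous_const.sub continuous_id)
      obtain ⟨m, hm⟩ := hd.exists_mem_open hopen ⟨x, by simp [(B 0).zero_mem]⟩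
      exact ⟨m, mem_coset.2 hm⟩
    set g : ℕ → Set X := fun m => t ∩ disjointed C m with hgdef
    have hgm : ∀ m, MeasurableSet (g m) := fun m => ht.inter (MeasurableSet.disjointed hCm m)
    have hgdisj : Pairwise (Disjoint on g) := fun i j hij =>
      (disjoint_disjointed C hij).mono inter_subset_right inter_subset_right
    have hgU : (⋃ m, g m) = t := by
      rw [hgdef, ← Set.inter_iUnion, iUnion_disjointed, Set.inter_eq_left]
      exact fun x _ => mem_iUnion.2 (hcover x)
    have hg0 : ∀ m (hm : μ (g m) ≠ ∞), T (indicatorConstLp 2 (hgm m) hm 1) = 0 := by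
      intro m hm
      have hset : g m = (t ∩ disjointed C m) ∩ coset (B 0) (d m) :=
        (Set.inter_eq_left.2 (inter_subset_right.trans (disjointed_subset C m))).symm
      rw [indicatorConstLp_set_congr μ _ _ ((ht.inter (MeasurableSet.disjointed hCm m)).inter (hSm 0 (d m)))
        (((measure_mono Set.inter_subset_right).trans_lt (hSf 0 (d m)).lt_top).ne) hset 1]
      exact hD _ (ht.inter (MeasurableSet.disjointed hCm m)) (d m)
    have key := map_indicatorConstLp_iUnion_eq_zero μ T g hgm hgdisj (by rw [hgU]; exact hμt) hg0
    rw [indicatorConstLp_set_congr μ _ _ ht hμt hgU 1] at key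
    exact key
  -- density of simple functions
  have hLp : ∀ f : Lp ℂ 2 μ, T f = 0 := by
    refine Lp.induction (μ := μ) ENNReal.ofNat_ne_top (motive := fun f => T f = 0) ?_ ?_ ?_
    · intro c s hs hμs
      rw [Lp.simpleFunc.coe_indicatorConst, indicatorConstLp_eq_smul_one μ hs hμs.ne c, map_smul,
        hfinite s hs hμs.ne, smul_zero]
    · intro f g hf hg _ hf0 hg0
      rw [map_add, hf0, hg0, add_zero]
    · exact isClosed_singleton.preimage T.continuous
  exact ContinuousLinearMap.ext hLp

end Density

/-! ## §5 Headline: the Schrödinger system has scalar commutant (Stone–von Neumann, kernel) -/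

section Headline

variable {X : Type*} [AddCommGroup X] [TopologicalSpace X] [IsTopologicalAddGroup X] [LocallyCompactSpace X]
  [SecondCountableTopology X] [MeasurableSpace X] [BorelSpace X] (μ : Measure X) [μ.IsAddHaarMeasure]

/-- **Stone–von Neumann irreducibility on `L²(X)`, totally disconnected case (KERNEL).**
`X` a locally compact second countable abelian group with a decreasing neighbourhood basis `B` of `0` by
compact open subgroups; `𝓜 ⊆ C(X, S¹)` containing a countable family `𝓜₀` of CHARACTERS separating each
`B k` from its complement.  Then every bounded operator on `L²(X, μ)` commuting with all translations and
all modulations `M_c`, `c ∈ 𝓜`, is a scalar:  `HasScalarCommutant (Lp ℂ 2 μ) (schrodingerSystem μ 𝓜)` —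
the hypothesis `hirr` of `SchrodingerLevi.weilLevi_existsUnique`.
([MVW] ch. 2 I.2 "Théorème (Stone, Von Neumann)" — p0035 L26 — in its `L²` form; proof: von Neumann's,
§§2–4 above.) -/
theorem hasScalarCommutant_schrodingerSystem (B : ℕ → AddSubgroup X)
    (hBo : ∀ k, IsOpen (B k : Set X)) (hBc : ∀ k, IsCompact (B k : Set X)) (hBanti : Antitone B)
    (hBnhds : ∀ U ∈ 𝓝 (0 : X), ∃ k, (B k : Set X) ⊆ U)
    (𝓜 𝓜₀ : Set C(X, Circle)) (h𝓜₀ : 𝓜₀ ⊆ 𝓜) (hcount : 𝓜₀.Countable)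
    (hsep : ∀ k u, u ∉ B k → ∃ χ ∈ 𝓜₀, (∀ t ∈ B k, χ t = 1) ∧ χ u ≠ 1) :
    HasScalarCommutant (Lp ℂ 2 μ) (schrodingerSystem μ 𝓜) := by
  intro A hA
  have hAτ : ∀ x f, A (translate μ x f) = translate μ x (A f) := fun x f => hA _ (Or.inl ⟨x, rfl⟩) f
  have hAM : ∀ χ ∈ 𝓜, ∀ f, A (modulate μ χ f) = modulate μ χ (A f) :=
    fun χ hχ f => hA _ (Or.inr ⟨χ, hχ, rfl⟩) f
  have hA'M : ∀ χ ∈ 𝓜, ∀ f, (ContinuousLinearMap.adjoint A) (modulate μ χ f) =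
      modulate μ χ ((ContinuousLinearMap.adjoint A) f) :=
    fun χ hχ => adjoint_comm_of_comm A (modulate μ χ) (hAM χ hχ)
  have hKm : ∀ k, MeasurableSet (B k : Set X) := fun k => (hBo k).measurableSet
  have hKf : ∀ k, μ (B k) ≠ ∞ := fun k => (hBc k).measure_lt_top.ne
  -- §2: `A`, `A†` preserve `L²(B k)`; `A` commutes with `P_k`
  have hV : ∀ k f, proj μ (hKm k) f = f → proj μ (hKm k) (A f) = A f := fun k f hf =>
    proj_eq_self_of_modulate_eq μ (B k) (hKm k) 𝓜₀ hcount (hsep k) (A f) fun χ hχ hχ1 => by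
      rw [← hAM χ (h𝓜₀ hχ) f, modulate_eq_self_of_proj_eq μ (B k) (hKm k) χ hχ1 f hf]
  have hV' : ∀ k f, proj μ (hKm k) f = f →
      proj μ (hKm k) ((ContinuousLinearMap.adjoint A) f) = (ContinuousLinearMap.adjoint A) f :=
    fun k f hf =>
    proj_eq_self_of_modulate_eq μ (B k) (hKm k) 𝓜₀ hcount (hsep k) _ fun χ hχ hχ1 => by
      rw [← hA'M χ (h𝓜₀ hχ) f, modulate_eq_self_of_proj_eq μ (B k) (hKm k) χ hχ1 f hf]
  have hcomm : ∀ k f, A (proj μ (hKm k) f) = proj μ (hKm k) (A f) := fun k =>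
    comm_proj_of_invariant A (proj μ (hKm k)) (inner_proj_left μ (hKm k)) (proj_proj μ (hKm k)) (hV k) (hV' k)
  -- §3: `A 1_{B 0} = c • 1_{B 0}`
  set ind : ∀ k, Lp ℂ 2 μ := fun k => indicatorConstLp 2 (hKm k) (hKf k) (1 : ℂ) with hind
  have hind0K : proj μ (hKm 0) (ind 0) = ind 0 :=
    proj_indicatorConstLp_of_subset μ (hKm 0) (hKf 0) (hKm 0) (hKf 0) subset_rfl 1
  have hg₀K : proj μ (hKm 0) (A (ind 0)) = A (ind 0) := hV 0 (ind 0) hind0K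
  have hg₀τ : ∀ a ∈ B 0, translate μ a (A (ind 0)) = A (ind 0) := fun a ha => by
    rw [← hAτ, hind]
    simp only
    rw [translate_indicatorConstLp_of_mem μ (B 0) (hKm 0) (hKf 0) ha]
  obtain ⟨c, hc⟩ := exists_eq_indicatorConstLp_of_translate_eq μ (B 0) (hBo 0) (hBc 0) (A (ind 0)) hg₀K hg₀τ
  have hc' : A (ind 0) = c • ind 0 := by rw [hc, indicatorConstLp_eq_smul_one]
  -- every `B k`, then every coset
  have hk : ∀ k, A (ind k) = c • ind k := fun k => by
    have hPk : proj μ (hKm k) (ind 0) = ind k :=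
      proj_indicatorConstLp_of_subset μ (hKm k) (hKf k) (hKm 0) (hKf 0) (hBanti (Nat.zero_le k)) 1
    rw [← hPk, hcomm, hc', map_smul]
  have hcoset : ∀ k a (h : μ (coset (B k) a) ≠ ∞),
      (A - c • ContinuousLinearMap.id ℂ (Lp ℂ 2 μ))
        (indicatorConstLp 2 (measurableSet_coset (hKm k) a) h (1 : ℂ)) = 0 := by
    intro k a h
    have htr : indicatorConstLp 2 (measurableSet_coset (hKm k) a) h (1 : ℂ) = translate μ (-a) (ind k) := by
      rw [hind]; simp only; rw [translate_indicatorConstLp]; rfl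
    simp only [FunLike.coe_sub, FunLike.coe_smul, Pi.sub_apply, Pi.smul_apply,
      ContinuousLinearMap.coe_id', id]
    rw [htr, hAτ, hk, map_smul, sub_self]
  have hT := eq_zero_of_vanish_on_cosets μ B hBo hBc hBanti hBnhds _ hcoset
  refine ⟨c, fun v => ?_⟩
  have := congrArg (fun T : Lp ℂ 2 μ →L[ℂ] Lp ℂ 2 μ => T v) hT
  simpa [sub_eq_zero] using this

end Headline

/-! ## §6 The instance `X = Fⁿ`, `F` a non-archimedean local field, characters `u ↦ ψ(ξ • u)` -/

section Circle

/-- "no small subgroups" for the circle: if all powers of `z` lie within distance `< 1` of `1`,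
then `z = 1` -/
theorem circle_eq_one_of_forall_pow {z : Circle} (h : ∀ N : ℕ, ‖((z : ℂ) ^ N) - 1‖ < 1) : z = 1 := by
  by_contra hz
  set θ : ℝ := Complex.arg (z : ℂ) with hθ
  have hzexp : (z : ℂ) = Complex.exp (θ * Complex.I) := by
    have h1 := Complex.norm_mul_exp_arg_mul_I (z : ℂ)
    rw [Circle.norm_coe, Complex.ofReal_one, one_mul] at h1
    exact h1.symm
  have hθ0 : θ ≠ 0 := by
    intro h0
    apply hz
    apply Circle.ext
    rw [hzexp, h0, Complex.ofReal_zero, zero_mul, Complex.exp_zero, Circle.coe_one]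
  have hθpos : 0 < |θ| := abs_pos.2 hθ0
  have hθpi : |θ| ≤ Real.pi := Complex.abs_arg_le_pi _
  set N : ℕ := ⌈(Real.pi / 2) / |θ|⌉₊ with hN
  have hN1 : Real.pi / 2 ≤ N * |θ| := by
    have h1 : (Real.pi / 2) / |θ| ≤ N := Nat.le_ceil _
    rwa [div_le_iff₀ hθpos] at h1
  have hN2 : (N : ℝ) * |θ| ≤ Real.pi + Real.pi / 2 := by
    have h1 : (N : ℝ) < (Real.pi / 2) / |θ| + 1 := Nat.ceil_lt_add_one (by positivity)
    have h2 : (N : ℝ) * |θ| < ((Real.pi / 2) / |θ| + 1) * |θ| := mul_lt_mul_of_pos_right h1 hθpos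
    rw [add_mul, one_mul, div_mul_cancel₀ _ hθpos.ne'] at h2
    linarith
  have hcos : Real.cos (N * θ) ≤ 0 := by
    rw [← Real.cos_abs, abs_mul, Nat.abs_cast]
    exact Real.cos_nonpos_of_pi_div_two_le_of_le hN1 hN2
  have hre : (((z : ℂ) ^ N) - 1).re ≤ -1 := by
    rw [Complex.sub_re, Complex.one_re, hzexp, ← Complex.exp_nat_mul]
    have : (N : ℂ) * (θ * Complex.I) = ((N * θ : ℝ) : ℂ) * Complex.I := by push_cast; ring
    rw [this, Complex.exp_ofReal_mul_I_re]
    linarith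
  have h1 : |(((z : ℂ) ^ N) - 1).re| < 1 := (Complex.abs_re_le_norm _).trans_lt (h N)
  have h2 := (abs_lt.1 h1).1
  linarith

end Circle

section LocalField

variable {F : Type*} [NormedField F] [IsUltrametricDist F]

/-- a continuous character of a non-archimedean field is trivial on a neighbourhood of `0`
(the "conductor" exists) -/
theorem exists_radius_addChar_eq_one (ψ : AddChar F Circle) (hψc : Continuous ψ) :
    ∃ δ : ℝ, 0 < δ ∧ ∀ t : F, ‖t‖ ≤ δ → ψ t = 1 := by
  have hU : IsOpen {z : Circle | ‖(z : ℂ) - 1‖ < 1} :=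
    isOpen_lt (continuous_norm.comp (continuous_subtype_val.sub continuous_const)) continuous_const
  have hmem : (ψ : F → Circle) ⁻¹' {z : Circle | ‖(z : ℂ) - 1‖ < 1} ∈ 𝓝 (0 : F) :=
    (hU.preimage hψc).mem_nhds (by simp [AddChar.map_zero_eq_one])
  obtain ⟨ε, hε, hball⟩ := Metric.mem_nhds_iff.1 hmem
  refine ⟨ε / 2, by positivity, fun t ht => circle_eq_one_of_forall_pow fun N => ?_⟩
  have hNt : ‖N • t‖ < ε :=
    (IsUltrametricDist.norm_nsmul_le t N).trans_lt (ht.trans_lt (half_lt_self hε))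
  have h1 : ‖((ψ (N • t) : Circle) : ℂ) - 1‖ < 1 := hball (mem_ball_zero_iff.2 hNt)
  rwa [AddChar.map_nsmul_eq_pow, Circle.coe_pow] at h1


-- port_pkg: scope closed for this part
end LocalField
end SchrodingerIrreducible
end LocalFactors
end PerL34
end HodgeCM
end
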